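import Literature.Barriers.CriticalPhenomena.LaceExpansionPcTriangleLargeD
import Literature.Barriers.CriticalPhenomena.LaceExpansionPcSubcritMajorant
import Literature.Barriers.CriticalPhenomena.LaceExpansionPcLeftLimit
import HarnessLib

/-!
# Hara's Prop. 1.2 below and at `p_c` for all sufficiently large `d`, from the successful
# bootstrap `HvdH2017_prop88` (Heydenreich–van der Hofstad, Ch. 8 ⇒ Cor. 8.13)

Barrier catalogue `Literature/Barriers/CriticalPhenomena/` (D-0021), continuation of
`LaceExpansionPcSubcritOfBounds.lean` / `LaceExpansionPcSubcritMajorant.lean` (the reduction of the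
named fact `Hara2008_prop12Subcrit` — the subcritical lace expansion with `p`-uniform bounds,
`d ≥ 11` — to the finiteness of the critical diagrams, `[1 - cos]`-weighted bounds uniform in
`p < p_c` and a smallness condition) and of `LaceExpansionPcTriangleLargeD.lean` (the critical
triangles for large `d` from `HvdH2017_prop88`). Here the printed large-`d` proof of the payload
source is assembled: for all sufficiently large `d` the BODY of `Hara2008_prop12Subcrit` — a family
`(Π_p)_{p<p_c}` of lace-expansion coefficients with a summable `p`-independent majorant, a uniform
second moment and the infrared lower bound near `p_c` — and hence (Hara's Appendix A, proved in
`LaceExpansionPcLeftLimit.lean`) the body of `Hara2008_prop12Pc` (a coefficient AT `p_c` with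
`Ĵ(0) = 1`, the infrared lower bound, the Fourier representation of `τ_{p_c}` and a finite second
moment) hold, CONDITIONALLY on two named facts: Lemma 8.4 `HvdH2017_lemma84` — a THEOREM of the tree
(`HvdH2017_lemma84_holds`; taken as a hypothesis here only for the import reason explained below) —
and `HvdH2017_prop88` ("`f(p) ≤ 1 + const/d` uniformly in `p < p_c`, `d ≥ d₀`", Heydenreich–van der
Hofstad, Prop. 8.8 = Lemma 8.9 (proved) + Prop. 8.10). Every other input is a theorem: Lemma 8.5
(`HvdH2017_lemma85`), Prop. 6.1 and (6.3.2) (the bridge `isLaceCoefficientAt_lacePiSum`), the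
bound (7.4.10) and Prop. 7.4 at `p_c`, and the `p ↑ p_c` transfer.

## Main results (all proved; namespace `Literature.Barriers.CriticalPhenomena`)

* `subcritBody_of_subcritEnvelopeBounds`, `subcritBody_of_subcritDiagramBounds`,
  `subcritBody_of_weightedBounds` — the reductions of `LaceExpansionPcSubcritOfBounds.lean` /
  `LaceExpansionPcSubcritMajorant.lean` for ONE dimension `d ≥ 2` (their proofs, verbatim);
* `tsum_uncurry_subcritMajorant_le` — `Σ_NΣ_x h^{(N)}(x) ≤ 1320000/d` for `d ≥ 3200000` under the
  triangle bounds `Δ_{p_c} ≤ 1 + 320000/d`, `Δ̃_{p_c} ≤ 320000/d`;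
* `exists_subcritBody_largeD` — **the body of `Hara2008_prop12Subcrit` for all large `d`**
  from Lemma 8.4 (`HvdH2017_lemma84`, a theorem: `HvdH2017_lemma84_holds`) and `HvdH2017_prop88`;
* `exists_isLaceCoefficientPc_largeD` — **the body of `Hara2008_prop12Pc` for all large `d`**
  (Hara 2008, Prop. 1.2 at `p = p_c`: "for percolation in `d ≥ 19` [here: `d ≥ d₀`] … the
  two-point function … is represented as `G_{p_c}(x) = ∫ e^{ikx} ĝ/(1 - Ĵ)`, `Ĵ(0) = 1`,
  `c₁|k|²/d ≤ 1 - Ĵ(k)`, `Σ_x|x|²|Π(x)| < ∞`") from the same two inputs.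

IMPORT NOTE. Lemma 8.4 is taken as the hypothesis `(h84 : HvdH2017_lemma84)` rather than
instantiated with the tree's theorem `HvdH2017_lemma84_holds` (`GaussianDominationRouteLemma84.lean`)
because, at the time of writing, that module cannot be imported together with
`LaceExpansionPcLimit.lean` (on which the subcritical bridge `isLaceCoefficientAt_lacePiSum` and
Appendix A rest): its import closure contains `LaceExpansionFourierIdentity.lean`, which declares
`Literature.Barriers.CriticalPhenomena.summable_abs_conv` and `….latticeFT_conv` — names also
declared (with different statements) in `LaceExpansionPcLimit.lean`. Once that duplication is
resolved, `exists_isLaceCoefficientPc_largeD HvdH2017_lemma84_holds` is Prop. 1.2 at `p_c` for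
large `d` modulo `HvdH2017_prop88` alone.

## References

* M. Heydenreich, R. van der Hofstad, *Progress in High-Dimensional Percolation and Random
  Graphs*, Springer 2017: Prop. 8.3, Lemma 8.4 ((8.3.5)–(8.3.6)), Lemma 8.5, Prop. 8.8,
  Cor. 8.13 ((8.5.1)–(8.5.2) and its proof, (8.5.4)–(8.5.5)), Prop. 7.4, Thm. 10.1.
* T. Hara, Ann. Probab. 36 (2008) 530–593: Prop. 1.2 ((1.16)–(1.17)) and Appendix A.
* T. Hara, G. Slade, Comm. Math. Phys. 128 (1990) 333–391: Prop. 4.3, Lemma 4.5, §4.1.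
-/

noncomputable section

namespace Literature.Barriers.CriticalPhenomena

open _root_.MeasureTheory _root_.Filter _root_.Topology Literature.Probability.LatticeModels
  Literature.Probability.Percolation

open scoped ENNReal

variable {d : ℕ}

/-! ### The reductions of `Hara2008_prop12Subcrit`, for one dimension -/

/-- **The body of `Hara2008_prop12Subcrit` at one `d ≥ 2` from uniform subcritical bounds on the
envelope `G_p = Σ_N Π^{(N)}_p`** (the proof of `Hara2008_prop12Subcrit_of_subcritEnvelopeBounds`):
`Φ_p = lacePiSum d p`, the majorant `h`, `C = B`, `c₁ = 2dp₀(1 - Σh - B)(2/π²)`.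
[cite: HeydenreichVanDerHofstad2017, Prop. 8.3 ((8.3.1)–(8.3.2)) and Cor. 8.13 ((8.5.1)–(8.5.2))]
[cite: Hara2008, Prop. 1.2 ((1.16)–(1.17)) and Appendix A (items 1–2)] -/
theorem subcritBody_of_subcritEnvelopeBounds (hd : 2 ≤ d)
    (H : ∃ (h : Site d → ℝ) (B : ℝ) (p₀ : unitInterval),
      Summable h ∧ p₀ < criticalProbI d ∧ 0 < (p₀ : ℝ) ∧ (∑' x, h x) + B < 1 ∧
      ∀ p : unitInterval, p < criticalProbI d →
        Summable (Function.uncurry (lacePi d p)) ∧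
        (∀ x, ∑' N, lacePi d p N x ≤ h x) ∧
        (∀ k ∈ cube d, (Summable fun x => (1 - Real.cos (kdot k x)) * ∑' N, lacePi d p N x) ∧
          ∑' x, (1 - Real.cos (kdot k x)) * (∑' N, lacePi d p N x) ≤ B * (1 - Dhat d k))) :
    ∃ (Φ : unitInterval → Site d → ℝ) (h : Site d → ℝ) (c₁ C : ℝ) (p₀ : unitInterval),
      Summable h ∧ 0 < c₁ ∧ p₀ < criticalProbI d ∧
      (∀ p : unitInterval, p < criticalProbI d →
        IsLaceCoefficientAt d p (Φ p) ∧
        (∀ x : Site d, |Φ p x| ≤ h x) ∧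
        (Summable fun x : Site d => euclidNorm x ^ 2 * |Φ p x|) ∧
        (∑' x : Site d, euclidNorm x ^ 2 * |Φ p x|) ≤ C) ∧
      (∀ p : unitInterval, p₀ ≤ p → p < criticalProbI d →
        ∀ k ∈ cube d, c₁ * (∑ i, k i ^ 2) / d ≤
          (∑' y, laceKernel p (Φ p) y) - (latticeFT (laceKernel p (Φ p)) k).re) := by
  obtain ⟨h, B, p₀, hh, hp₀, hp₀0, hsmall, HP⟩ := H
  have hd1 : 1 ≤ d := by omega
  set A : ℝ := ∑' x, h x with hAdef
  have hfam : ∀ p : unitInterval, p < criticalProbI d → Summable (Function.uncurry (lacePi d p)) :=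
    fun p hp => (HP p hp).1
  have hΦle : ∀ p : unitInterval, p < criticalProbI d → ∀ x, |lacePiSum d p x| ≤ h x :=
    fun p hp x => (abs_lacePiSum_le (hfam p hp) x).trans ((HP p hp).2.1 x)
  have hW : ∀ p : unitInterval, p < criticalProbI d → ∀ k ∈ cube d,
      (Summable fun x => (1 - Real.cos (kdot k x)) * ∑' N, lacePi d p N x) ∧
        ∑' x, (1 - Real.cos (kdot k x)) * (∑' N, lacePi d p N x) ≤ B * (1 - Dhat d k) :=
    fun p hp => (HP p hp).2.2
  refine ⟨fun p => lacePiSum d p, h, 2 * d * (p₀ : ℝ) * (1 - A - B) * (2 / Real.pi ^ 2), B, p₀, hh,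
    ?_, hp₀, fun p hp => ?_, fun p hp₀p hp k hk => ?_⟩
  · -- `c₁ > 0`
    have : 0 < 1 - A - B := by linarith
    positivity
  · -- clauses (i)–(iii) at `p < p_c`
    have hG0 : ∀ x, 0 ≤ ∑' N, lacePi d p N x := fun x => tsum_nonneg fun N => lacePi_nonneg p N x
    obtain ⟨hS2, hle2⟩ := summable_euclidNorm_sq_mul_of_kspace hd1 hG0 (hW p hp)
    have hdom : ∀ x, euclidNorm x ^ 2 * |lacePiSum d p x| ≤ euclidNorm x ^ 2 * ∑' N, lacePi d p N x :=
      fun x => mul_le_mul_of_nonneg_left (abs_lacePiSum_le (hfam p hp) x) (sq_nonneg _)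
    have hS2' : Summable fun x => euclidNorm x ^ 2 * |lacePiSum d p x| :=
      Summable.of_nonneg_of_le (fun x => mul_nonneg (sq_nonneg _) (abs_nonneg _)) hdom hS2
    exact ⟨isLaceCoefficientAt_lacePiSum hd hp (hfam p hp), hΦle p hp, hS2',
      (hS2'.tsum_le_tsum hdom hS2).trans hle2⟩
  · -- clause (iv) on `[p₀, p_c)`
    have hΦabs : Summable fun x => |lacePiSum d p x| := summable_abs_lacePiSum (hfam p hp)
    have hA' : ∑' x, |lacePiSum d p x| ≤ A := hΦabs.tsum_le_tsum (hΦle p hp) hh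
    have hB' : ∀ k ∈ cube d, ∑' x, (1 - Real.cos (kdot k x)) * |lacePiSum d p x| ≤ B * (1 - Dhat d k) := by
      intro k hk
      obtain ⟨hWs, hWle⟩ := hW p hp k hk
      have hw0 : ∀ x : Site d, 0 ≤ 1 - Real.cos (kdot k x) := fun x => sub_nonneg.2 (Real.cos_le_one _)
      have hpt : ∀ x, (1 - Real.cos (kdot k x)) * |lacePiSum d p x| ≤
          (1 - Real.cos (kdot k x)) * ∑' N, lacePi d p N x := fun x =>
        mul_le_mul_of_nonneg_left (abs_lacePiSum_le (hfam p hp) x) (hw0 x)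
      exact ((Summable.of_nonneg_of_le (fun x => mul_nonneg (hw0 x) (abs_nonneg _)) hpt hWs).tsum_le_tsum
        hpt hWs).trans hWle
    have hmain := laceKernel_infraredLower hd1 p hΦabs (lacePiSum_neg p) hA' hB' hsmall.le hk
    have hsq : 0 ≤ 2 / Real.pi ^ 2 * (∑ j, k j ^ 2) / d := by positivity
    have hAB : 0 ≤ 1 - A - B := by linarith
    have hpp : (p₀ : ℝ) ≤ p := by exact_mod_cast hp₀p
    calc 2 * d * (p₀ : ℝ) * (1 - A - B) * (2 / Real.pi ^ 2) * (∑ i, k i ^ 2) / d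
        = 2 * d * (p₀ : ℝ) * (1 - A - B) * (2 / Real.pi ^ 2 * (∑ j, k j ^ 2) / d) := by ring
      _ ≤ 2 * d * (p : ℝ) * (1 - A - B) * (2 / Real.pi ^ 2 * (∑ j, k j ^ 2) / d) := by
          have : 2 * d * (p₀ : ℝ) * (1 - A - B) ≤ 2 * d * (p : ℝ) * (1 - A - B) :=
            mul_le_mul_of_nonneg_right (by nlinarith) hAB
          exact mul_le_mul_of_nonneg_right this hsq
      _ ≤ _ := hmain

/-- **The body of `Hara2008_prop12Subcrit` at one `d ≥ 2` from uniform subcritical diagrammatic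
bounds on each `Π^{(N)}_p`** (the proof of `Hara2008_prop12Subcrit_of_subcritDiagramBounds`).
[cite: HeydenreichVanDerHofstad2017, Lemma 8.4 ((8.3.5)–(8.3.6)) and Cor. 8.13]
[cite: Hara2008, Prop. 1.2 ((1.16)–(1.17)) and Appendix A (items 1–2)] -/
theorem subcritBody_of_subcritDiagramBounds (hd : 2 ≤ d)
    (H : ∃ (D : ℕ → Site d → ℝ) (b : ℕ → ℝ) (p₀ : unitInterval),
      Summable (Function.uncurry D) ∧ Summable b ∧ p₀ < criticalProbI d ∧ 0 < (p₀ : ℝ) ∧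
      (∑' q, Function.uncurry D q) + (∑' N, b N) < 1 ∧
      ∀ p : unitInterval, p < criticalProbI d →
        (∀ N x, lacePi d p N x ≤ D N x) ∧
        (∀ N, ∀ k ∈ cube d, (Summable fun x => (1 - Real.cos (kdot k x)) * lacePi d p N x) ∧
          ∑' x, (1 - Real.cos (kdot k x)) * lacePi d p N x ≤ b N * (1 - Dhat d k))) :
    ∃ (Φ : unitInterval → Site d → ℝ) (h : Site d → ℝ) (c₁ C : ℝ) (p₀ : unitInterval),
      Summable h ∧ 0 < c₁ ∧ p₀ < criticalProbI d ∧
      (∀ p : unitInterval, p < criticalProbI d →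
        IsLaceCoefficientAt d p (Φ p) ∧
        (∀ x : Site d, |Φ p x| ≤ h x) ∧
        (Summable fun x : Site d => euclidNorm x ^ 2 * |Φ p x|) ∧
        (∑' x : Site d, euclidNorm x ^ 2 * |Φ p x|) ≤ C) ∧
      (∀ p : unitInterval, p₀ ≤ p → p < criticalProbI d →
        ∀ k ∈ cube d, c₁ * (∑ i, k i ^ 2) / d ≤
          (∑' y, laceKernel p (Φ p) y) - (latticeFT (laceKernel p (Φ p)) k).re) := by
  refine subcritBody_of_subcritEnvelopeBounds hd ?_
  obtain ⟨D, b, p₀, hD, hb, hp₀, hp₀0, hsmall, HP⟩ := H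
  have hfam : ∀ p : unitInterval, p < criticalProbI d → Summable (Function.uncurry (lacePi d p)) :=
    fun p hp => Summable.of_nonneg_of_le (fun q => lacePi_nonneg p q.1 q.2)
      (fun q => (HP p hp).1 q.1 q.2) hD
  have hDN : ∀ x, Summable fun N => D N x := fun x => hD.prod_symm.prod_factor x
  have hAeq : ∑' x, ∑' N, D N x = ∑' q, Function.uncurry D q := by
    rw [hD.tsum_prod, hD.tsum_comm]
    rfl
  refine ⟨fun x => ∑' N, D N x, ∑' N, b N, p₀, hD.prod_symm.prod, hp₀, hp₀0, by rw [hAeq]; exact hsmall,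
    fun p hp => ⟨hfam p hp, fun x => ?_, fun k hk => ?_⟩⟩
  · exact (summable_lacePi_nat (hfam p hp) x).tsum_le_tsum (fun N => (HP p hp).1 N x) (hDN x)
  · exact tsum_one_sub_cos_mul_envelope_le hb k fun N => (HP p hp).2 N k hk

/-- **The body of `Hara2008_prop12Subcrit` at one `d ≥ 2` from the finiteness of the critical
diagrams, `[1 - cos]`-weighted bounds uniform in `p < p_c`, and smallness** (the proof of
`Hara2008_prop12Subcrit_of_weightedBounds`: the majorant is Hara's `h^{(N)}`, `subcritMajorant`).
[cite: Hara2008, Prop. 1.2 ((1.16)–(1.17)) and Appendix A (items 1–2)]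
[cite: HeydenreichVanDerHofstad2017, (7.2.9), (7.4.10), Lemma 8.4 ((8.3.6)) and Cor. 8.13 ((8.5.1)–(8.5.2))] -/
theorem subcritBody_of_weightedBounds (hd : 2 ≤ d)
    (hfin : (∑' N, ∑' x, piNDiagramPc d N x) ≠ ⊤)
    (hbub : Summable fun x : Site d => tau d (criticalProbI d) 0 x ^ 2)
    (H : ∃ (b : ℕ → ℝ) (p₀ : unitInterval), Summable b ∧ p₀ < criticalProbI d ∧ 0 < (p₀ : ℝ) ∧
        (∑' q, Function.uncurry (subcritMajorant d) q) + (∑' N, b N) < 1 ∧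
        ∀ p : unitInterval, p < criticalProbI d → ∀ N, ∀ k ∈ cube d,
          (Summable fun x => (1 - Real.cos (kdot k x)) * lacePi d p N x) ∧
            ∑' x, (1 - Real.cos (kdot k x)) * lacePi d p N x ≤ b N * (1 - Dhat d k)) :
    ∃ (Φ : unitInterval → Site d → ℝ) (h : Site d → ℝ) (c₁ C : ℝ) (p₀ : unitInterval),
      Summable h ∧ 0 < c₁ ∧ p₀ < criticalProbI d ∧
      (∀ p : unitInterval, p < criticalProbI d →
        IsLaceCoefficientAt d p (Φ p) ∧
        (∀ x : Site d, |Φ p x| ≤ h x) ∧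
        (Summable fun x : Site d => euclidNorm x ^ 2 * |Φ p x|) ∧
        (∑' x : Site d, euclidNorm x ^ 2 * |Φ p x|) ≤ C) ∧
      (∀ p : unitInterval, p₀ ≤ p → p < criticalProbI d →
        ∀ k ∈ cube d, c₁ * (∑ i, k i ^ 2) / d ≤
          (∑' y, laceKernel p (Φ p) y) - (latticeFT (laceKernel p (Φ p)) k).re) := by
  refine subcritBody_of_subcritDiagramBounds hd ?_
  obtain ⟨b, p₀, hb, hp₀, hp₀0, hsmall, HW⟩ := H
  exact ⟨subcritMajorant d, b, p₀, summable_uncurry_subcritMajorant hfin hbub, hb, hp₀, hp₀0, hsmall,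
    fun p hp => ⟨fun N x => lacePi_le_subcritMajorant hfin hp.le N x, fun N k hk => HW p hp N k hk⟩⟩

/-! ### The majorant `Σ_NΣ_x h^{(N)}(x)` is `O(1/d)` under the large-`d` triangle bounds -/

/-- **`Σ_x τ_{p_c}(0,x)² ≤ Δ_{p_c}`** as a real inequality (`Δ_{p_c} ≤ M`, `M` real).
[cite: HeydenreichVanDerHofstad2017, Thm. 4.2 (bubble vs triangle) and (7.2.1)] -/
theorem tsum_tau_sq_le_of_percTriBar_le {M : ℝ} (hM : 0 ≤ M) (hΔ : percTriBar d ≤ ENNReal.ofReal M) :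
    ∑' x : Site d, tau d (criticalProbI d) 0 x ^ 2 ≤ M := by
  have hle : (∑' y : Site d, ENNReal.ofReal (tau d (criticalProbI d) 0 y ^ 2)) ≤ ENNReal.ofReal M :=
    (tsum_ofReal_tau_sq_le_percTri_zero.trans (le_iSup (fun x => percTri d x) 0)).trans hΔ
  have hbub : Summable fun x : Site d => tau d (criticalProbI d) 0 x ^ 2 :=
    summable_tau_sq_of_percTriBar_lt_top (lt_of_le_of_lt hΔ ENNReal.ofReal_lt_top)
  rw [← ENNReal.ofReal_tsum_of_nonneg (fun x => sq_nonneg _) hbub] at hle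
  exact (ENNReal.ofReal_le_ofReal_iff hM).1 hle

/-- **The `N ≥ 1` diagrams at `p_c` sum to at most `10⁶/d`** when `Δ_{p_c} ≤ 1 + 320000/d`,
`Δ̃_{p_c} ≤ 320000/d` and `d ≥ 3200000` (`Σ_{N≥1}Σ_x ≤ Δ ρ/(1-ρ)`, `ρ = 2Δ̃Δ ≤ 0.22`).
[cite: HeydenreichVanDerHofstad2017, Prop. 7.4 ((7.5.3)) and Lemma 8.5] -/
theorem tsum_tsum_piNDiagramPc_succ_le_of_triangle_le (hd : 3200000 ≤ d)
    (hΔ : percTriBar d ≤ ENNReal.ofReal (1 + 320000 / d))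
    (hΔt : percTriTildeBar d ≤ ENNReal.ofReal (320000 / d)) :
    ∑' n : ℕ, ∑' x : Site d, piNDiagramPc d (n + 1) x ≤ ENNReal.ofReal (1000000 / d) := by
  have hdR : (3200000 : ℝ) ≤ d := by exact_mod_cast hd
  have hdpos : (0 : ℝ) < d := by linarith
  have hε : (320000 : ℝ) / d ≤ 0.1 := by rw [div_le_iff₀ hdpos]; linarith
  have hε0 : (0 : ℝ) ≤ 320000 / d := by positivity
  have hΔ' : percTriBar d ≤ ENNReal.ofReal 1.1 := hΔ.trans (ENNReal.ofReal_le_ofReal (by linarith))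
  -- the rate `ρ = 2Δ̃Δ ≤ 2 · (320000/d) · 1.1 = 704000/d ≤ 0.22`
  set ρ : ℝ≥0∞ := 2 * percTriTildeBar d * percTriBar d with hρ
  have hρle : ρ ≤ ENNReal.ofReal (704000 / d) := by
    calc ρ ≤ 2 * ENNReal.ofReal (320000 / d) * ENNReal.ofReal 1.1 := by rw [hρ]; gcongr
      _ = ENNReal.ofReal (2 * (320000 / d) * 1.1) := by
          rw [ENNReal.ofReal_mul (by positivity), ENNReal.ofReal_mul zero_le_two, ENNReal.ofReal_ofNat]
      _ = ENNReal.ofReal (704000 / d) := by congr 1; ring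
  have hρle' : ρ ≤ ENNReal.ofReal 0.22 :=
    hρle.trans (ENNReal.ofReal_le_ofReal (by rw [div_le_iff₀ hdpos]; linarith))
  have hinv : (1 - ρ)⁻¹ ≤ ENNReal.ofReal (1 / 0.78) := by
    have h1 : ENNReal.ofReal 0.78 ≤ 1 - ρ := by
      calc ENNReal.ofReal 0.78 = ENNReal.ofReal (1 - 0.22) := by norm_num
        _ = 1 - ENNReal.ofReal 0.22 := by rw [ENNReal.ofReal_sub _ (by norm_num), ENNReal.ofReal_one]
        _ ≤ 1 - ρ := tsub_le_tsub_left hρle' 1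
    calc (1 - ρ)⁻¹ ≤ (ENNReal.ofReal 0.78)⁻¹ := ENNReal.inv_le_inv.2 h1
      _ = ENNReal.ofReal (0.78⁻¹) := (ENNReal.ofReal_inv_of_pos (by norm_num)).symm
      _ = ENNReal.ofReal (1 / 0.78) := by rw [one_div]
  calc ∑' n : ℕ, ∑' x : Site d, piNDiagramPc d (n + 1) x
      ≤ percTriBar d * ρ * (1 - ρ)⁻¹ := tsum_tsum_piNDiagramPc_succ_le
    _ ≤ ENNReal.ofReal 1.1 * ENNReal.ofReal (704000 / d) * ENNReal.ofReal (1 / 0.78) := by gcongr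
    _ = ENNReal.ofReal (1.1 * (704000 / d) * (1 / 0.78)) := by
        rw [ENNReal.ofReal_mul (by positivity), ENNReal.ofReal_mul (by norm_num)]
    _ ≤ ENNReal.ofReal (1000000 / d) := by
        refine ENNReal.ofReal_le_ofReal ?_
        have : 1.1 * (704000 / (d : ℝ)) * (1 / 0.78) = (1.1 * 704000 / 0.78) / d := by ring
        rw [this]
        exact div_le_div_of_nonneg_right (by norm_num) hdpos.le

/-- **`Σ_NΣ_x h^{(N)}(x) ≤ 1320000/d`** for `d ≥ 3200000` under the large-`d` triangle bounds
(`N = 0`: `Σ_{x≠0} τ_{p_c}(x)² ≤ Δ_{p_c} - 1 ≤ 320000/d`; `N ≥ 1`: `≤ 10⁶/d`) — Hara's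
"`Σ_xΣ_n h^{(n)}(x) ≤ c/d`". [cite: Hara2008, Prop. 1.2 ((1.16))]
[cite: HeydenreichVanDerHofstad2017, Prop. 7.4 ((7.5.3)), Lemma 8.5 and Cor. 8.13 (proof)] -/
theorem tsum_uncurry_subcritMajorant_le (hd : 3200000 ≤ d)
    (hΔ : percTriBar d ≤ ENNReal.ofReal (1 + 320000 / d))
    (hΔt : percTriTildeBar d ≤ ENNReal.ofReal (320000 / d))
    (hfin : (∑' N, ∑' x, piNDiagramPc d N x) ≠ ⊤)
    (hbub : Summable fun x : Site d => tau d (criticalProbI d) 0 x ^ 2) :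
    ∑' q, Function.uncurry (subcritMajorant d) q ≤ 1320000 / d := by
  have hdpos : (0 : ℝ) < d := by exact_mod_cast (show 0 < d by omega)
  have hε0 : (0 : ℝ) ≤ 320000 / d := by positivity
  have hS := summable_uncurry_subcritMajorant hfin hbub
  -- `N = 0`
  have h0 : ∑' x, subcritMajorant d 0 x ≤ 320000 / d := by
    have hsq : ∑' x : Site d, tau d (criticalProbI d) 0 x ^ 2 ≤ 1 + 320000 / d :=
      tsum_tau_sq_le_of_percTriBar_le (by linarith) hΔ
    have hsplit := hbub.tsum_eq_add_tsum_ite 0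
    rw [tau_self, one_pow] at hsplit
    have heq : ∑' x, subcritMajorant d 0 x =
        ∑' x : Site d, (if x = 0 then 0 else tau d (criticalProbI d) 0 x ^ 2) :=
      tsum_congr fun x => subcritMajorant_zero x
    rw [heq]
    linarith
  -- `N ≥ 1`
  have h1 : ∑' n, ∑' x, subcritMajorant d (n + 1) x ≤ 1000000 / d := by
    have hrows : ∀ n, ∑' x, subcritMajorant d (n + 1) x = (∑' x, piNDiagramPc d (n + 1) x).toReal :=
      fun n => tsum_subcritMajorant_of_one_le hfin (by omega)
    rw [tsum_congr hrows, ← ENNReal.tsum_toReal_eq fun n => ENNReal.ne_top_of_tsum_ne_top hfin (n + 1)]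
    exact ENNReal.toReal_le_of_le_ofReal (by positivity)
      (tsum_tsum_piNDiagramPc_succ_le_of_triangle_le hd hΔ hΔt)
  -- sum over `N`
  have hrowS : Summable fun N => ∑' x, subcritMajorant d N x := hS.prod
  rw [hS.tsum_prod]
  simp only [Function.uncurry_apply_pair]
  rw [hrowS.tsum_eq_zero_add]
  have hsum : (1320000 : ℝ) / d = 320000 / d + 1000000 / d := by ring
  rw [hsum]
  exact add_le_add h0 h1

/-! ### The large-`d` assembly -/

/-- **The body of `Hara2008_prop12Subcrit` for all sufficiently large `d`, from Lemma 8.4 and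
`HvdH2017_prop88`.**
For `d ≥ d₀`: the Hara–Slade coefficients `Φ_p = Π_p = lacePiSum d p` (`p < p_c`) satisfy the
`x`-space expansion (6.1.2) (Prop. 6.1, (6.3.2)–(6.3.4), `isLaceCoefficientAt_lacePiSum`), are
dominated by Hara's `p`-independent summable `h^{(N)}` (the diagrams at `p_c`, finite by Lemma 8.5
at `p_c` and Prop. 7.4: `LaceExpansionPcTriangleLargeD.lean`), have second moments bounded
uniformly in `p` (from the `[1 - cos]`-weighted bounds (8.3.6) of Lemma 8.4 with `f(p) ≤ 2`,
`HvdH2017_lemma84` and `HvdH2017_prop88`), and the kernel obeys the infrared lower bound on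
a left neighbourhood of `p_c` (smallness `Σ_NΣ_x h^{(N)} + Σ_N b_N = O(1/d) < 1`).
[cite: HeydenreichVanDerHofstad2017, Lemma 8.4, Lemma 8.5, Prop. 8.8 and Cor. 8.13 ((8.5.1)–(8.5.2) and its proof)]
[cite: Hara2008, Prop. 1.2 ((1.16)–(1.17)) and Appendix A (items 1–2)] -/
theorem exists_subcritBody_largeD (h84 : HvdH2017_lemma84) (h88 : HvdH2017_prop88) :
    ∃ d₀ : ℕ, ∀ d : ℕ, d₀ ≤ d →
      ∃ (Φ : unitInterval → Site d → ℝ) (h : Site d → ℝ) (c₁ C : ℝ) (p₀ : unitInterval),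
        Summable h ∧ 0 < c₁ ∧ p₀ < criticalProbI d ∧
        (∀ p : unitInterval, p < criticalProbI d →
          IsLaceCoefficientAt d p (Φ p) ∧
          (∀ x : Site d, |Φ p x| ≤ h x) ∧
          (Summable fun x : Site d => euclidNorm x ^ 2 * |Φ p x|) ∧
          (∑' x : Site d, euclidNorm x ^ 2 * |Φ p x|) ≤ C) ∧
        (∀ p : unitInterval, p₀ ≤ p → p < criticalProbI d →
          ∀ k ∈ cube d, c₁ * (∑ i, k i ^ 2) / d ≤
            (∑' y, laceKernel p (Φ p) y) - (latticeFT (laceKernel p (Φ p)) k).re) := by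
  obtain ⟨dΔ, hΔall⟩ := percTriBar_le_of_prop88 h88
  obtain ⟨dT, hTall⟩ := tsum_tsum_piNDiagramPc_ne_top_of_prop88 h88
  obtain ⟨c84, hc84, d84, -, H84⟩ := h84 2 two_pos
  obtain ⟨c88, d88, -, hf88⟩ := h88
  refine ⟨max (max (max dΔ dT) (max d84 d88)) (max 3200000 (max ⌈c88⌉₊ ⌈16 * c84⌉₊)),
    fun d hd => ?_⟩
  -- the thresholds
  have hdΔ : dΔ ≤ d := le_trans (le_max_left _ _) (le_trans (le_max_left _ _) (le_trans (le_max_left _ _) hd))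
  have hdT : dT ≤ d := le_trans (le_max_right _ _) (le_trans (le_max_left _ _) (le_trans (le_max_left _ _) hd))
  have hd84' : d84 ≤ d :=
    le_trans (le_max_left _ _) (le_trans (le_max_right _ _) (le_trans (le_max_left _ _) hd))
  have hd88' : d88 ≤ d :=
    le_trans (le_max_right _ _) (le_trans (le_max_right _ _) (le_trans (le_max_left _ _) hd))
  have hd32 : 3200000 ≤ d := le_trans (le_max_left _ _) (le_trans (le_max_right _ _) hd)
  have hc88d : c88 ≤ d := le_trans (Nat.le_ceil c88)
    (by exact_mod_cast le_trans (le_max_left _ _) (le_trans (le_max_right _ _) (le_trans (le_max_right _ _) hd)))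
  have hc84d : 16 * c84 ≤ d := le_trans (Nat.le_ceil (16 * c84))
    (by exact_mod_cast le_trans (le_max_right _ _) (le_trans (le_max_right _ _) (le_trans (le_max_right _ _) hd)))
  have hd2 : 2 ≤ d := by omega
  have hdpos : (0 : ℝ) < d := by exact_mod_cast (show 0 < d by omega)
  -- the critical diagrams (Lemma 8.5 at `p_c`, Prop. 7.4)
  obtain ⟨hΔ, hΔt⟩ := hΔall d hdΔ
  have hfin := hTall d hdT
  have hbub : Summable fun x : Site d => tau d (criticalProbI d) 0 x ^ 2 :=
    summable_tau_sq_of_percTriBar_lt_top (lt_of_le_of_lt hΔ ENNReal.ofReal_lt_top)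
  -- `f(p) ≤ 2` below `p_c`
  have hf2 : ∀ p : unitInterval, (p : ℝ) < criticalProb (zdGraph d) (0 : Site d) → bootF d p ≤ 2 := by
    intro p hp
    refine (hf88 d hd88' p hp).trans ?_
    have : c88 / d ≤ 1 := by rw [div_le_one hdpos]; exact hc88d
    linarith
  -- the rate of Lemma 8.4
  set r : ℝ := c84 / d with hr
  have hr0 : 0 ≤ r := by positivity
  have hr12 : r ≤ 1 / 2 := by rw [hr, div_le_iff₀ hdpos]; linarith
  -- `(c/d)^{(N-1)∨1} ≤ 4 (c/d) 2^{-N}` (`pow_max_sub_one_le`), of sum `8 c/d`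
  have hbS : Summable fun N : ℕ => 4 * r * (1 / 2 : ℝ) ^ N := summable_geom_aux r 4
  have hbsum : ∑' N : ℕ, 4 * r * (1 / 2 : ℝ) ^ N = 8 * r := by rw [tsum_geom_aux]; ring
  -- a point `0 < p₀ < p_c`
  obtain ⟨p₀, hp₀0, hp₀c⟩ := exists_lt_lt_criticalProbI (criticalProbI_pos' (d := d) (by omega))
  have hp₀ : p₀ < criticalProbI d := by
    rw [← Subtype.coe_lt_coe, coe_criticalProbI]; exact hp₀c
  have hp₀0' : 0 < (p₀ : ℝ) := by
    have h := Subtype.coe_lt_coe.2 hp₀0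
    simpa using h
  refine subcritBody_of_weightedBounds hd2 hfin hbub
    ⟨fun N => 4 * r * (1 / 2) ^ N, p₀, hbS, hp₀, hp₀0', ?_, fun p hp N k hk => ?_⟩
  · -- smallness: `Σ_NΣ_x h^{(N)} + Σ_N b_N ≤ 1320000/d + 8 c84/d < 1`
    have hA := tsum_uncurry_subcritMajorant_le hd32 hΔ hΔt hfin hbub
    have h8 : 8 * r ≤ 1 / 2 := by
      rw [hr, show (8 : ℝ) * (c84 / d) = 8 * c84 / d by ring, div_le_iff₀ hdpos]; linarith
    have h5 : (1320000 : ℝ) / d ≤ 1320000 / 3200000 :=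
      div_le_div_of_nonneg_left (by norm_num) (by norm_num) (by exact_mod_cast hd32)
    rw [hbsum]
    linarith
  · -- the `[1 - cos]`-weighted bounds (8.3.6) with `f(p) ≤ 2`
    have hp' : (p : ℝ) < criticalProb (zdGraph d) (0 : Site d) := hp
    obtain ⟨-, hk84⟩ := H84 d hd84' p hp' (hf2 p hp') N
    obtain ⟨hs, hle⟩ := hk84 k
    refine ⟨hs, hle.trans ?_⟩
    rw [mul_comm]
    exact mul_le_mul_of_nonneg_right (pow_max_sub_one_le hr0 hr12 N) (one_sub_Dhat_nonneg k)

/-- **Hara's Prop. 1.2 at `p = p_c` for all sufficiently large `d`, from Lemma 8.4 and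
`HvdH2017_prop88`** — the
body of `Hara2008_prop12Pc`: a lace-expansion coefficient `Ψ = Π_{p_c}` AT `p_c`
(`IsLaceCoefficientPc d Ψ`: symmetric, summable, `Ĵ_{p_c}(0) = 1`, the infrared lower bound
`c₁|k|²/d ≤ 1 - Ĵ_{p_c}(k)` on `[-π,π]^d`, and the Fourier representation
`τ_{p_c}(x) = ∫ e^{ikx} ĝ(k)/(1 - Ĵ(k)) dk/(2π)^d`) with `Σ_x |x|²|Ψ(x)| < ∞`. Proof: the subcritical
body (`exists_subcritBody_largeD`) and Hara's Appendix A, items 1–4, as proved in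
`LaceExpansionPcLeftLimit.lean` (`exists_isLaceCoefficientPc_of_subcrit`: compactness, Fatou,
(A.1) `Ĵ_p(0) → 1`, dominated convergence on the cube).
[cite: Hara2008, Prop. 1.2 and Appendix A (items 1–4)]
[cite: HeydenreichVanDerHofstad2017, Cor. 8.13 ((8.5.1)–(8.5.2) and its proof, (8.5.4)–(8.5.5)) and Prop. 8.8] -/
theorem exists_isLaceCoefficientPc_largeD (h84 : HvdH2017_lemma84) (h88 : HvdH2017_prop88) :
    ∃ d₀ : ℕ, ∀ d : ℕ, d₀ ≤ d →
      ∃ Ψ : Site d → ℝ, IsLaceCoefficientPc d Ψ ∧ Summable fun x => euclidNorm x ^ 2 * |Ψ x| := by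
  obtain ⟨d₀, h⟩ := exists_subcritBody_largeD h84 h88
  refine ⟨max d₀ 7, fun d hd => ?_⟩
  obtain ⟨Φ, h', c₁, C, p₀, hh, hc₁, hp₀, hP, hIR⟩ := h d (le_trans (le_max_left _ _) hd)
  exact exists_isLaceCoefficientPc_of_subcrit (le_trans (le_max_right _ _) hd) hh hc₁ hp₀ hP hIR

end Literature.Barriers.CriticalPhenomena

end
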